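import Summits.HodgeConjecture.HodgeConjecture.Theorems.Ring2HypothesesDescentAbsoluteNondegenerate
import Summits.HodgeConjecture.HodgeConjecture.Theorems.Ring2HypothesesDescentAbsoluteCorrespondences
import Literature.AlgebraicGeometry.HodgeTheory.DominatedByPowersHodgeConjecture
import HarnessLib

/-!
# Ring 2 — hypotheses layer, descent axis: ABSOLUTE HODGE CLASSES LIFT THROUGH ALGEBRAIC CORRESPONDENCES
# (Deligne–Milne II Prop. 6.5 at work), and ARAPURA'S LEMMA 4.2 FOR THE CLAUSE «ABSOLUTE HODGE ⟹ ALGEBRAIC»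

HONEST FRAMING (page 1, verbatim the cell's standing line): **research route conditional on HC_CM; not a
corollary; Q11.4-sentence-2 already refuted in dim ≥ 3.** Nothing in this file proves a case of the Hodge conjecture;
nothing discharges the binder of record b06 `Ring2.Hypotheses.AbsoluteHodgeImpliesAlgebraicAV` («absolute Hodge classes
on complex abelian varieties are algebraic», `Ring2HypothesesDescent.lean` :73; OPEN); the binder table's numbers do not
move. `HC_CM` (`Theses.RankFourFaces.CMAbelianHodge`) does not occur in this file; row b06 does not occur in this file
(its readings are in the companion `Ring2HypothesesDescentAbsoluteDomination`).

Hodge ladder STAGE 3, `BINDER-OWNERS.md` row **b06**, seat `ring2-b06` (gen 76). The ABSOLUTE twin of ring2-b05 gen 40's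
`Ring2HypothesesDescentMotivatedCorrespondenceLift` (André's semisimplicity lift; Arapura 2006 Lemma 4.2 for the clause
«`A_mot = A`»), with André's Thm. 0.4 / Prop. 3.3 replaced by DELIGNE–MILNE 1982 II Prop. 6.5 (the category of motives
for absolute Hodge cycles is semisimple) in its realisation-level form — the non-degeneracy of the cup pairing on
`S(X) := span_ℂ {c | IsAbsoluteHodgeClass n X p c}` (`Ring2HypothesesDescentAbsoluteNondegenerate`, same gen) — and with
André's Prop. 2.1 replaced by Charles–Schnell 11.2.8 (algebraic correspondences and their adjoint classes preserve `S`,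
`Ring2HypothesesDescentAbsoluteCorrespondences`, same gen). Everything is MODULO the class-level facts of Deligne's §2
recorded BY NAME in the tree and displayed as hypotheses — (N) `chartConjugation_canonical`, (E) existence of
conjugates, (V-B3) `deligne1982_cycleClass_absoluteHodge`, (T1c) `deligne1982_lefschetz_absoluteHodge_iff`, (CS7)
`deligne1982_cupProduct_absoluteHodge`, (CS8) `deligne1982_gysinFst_absoluteHodge` — none new, none discharged.

* §1 `cupProduct_corrClassAction_eq_zero_of_forall_absoluteHodge` — if `b ∈ S(V)` is cup-orthogonal to `T(S(Y))` for
  an algebraic correspondence `T`, it is cup-orthogonal to the WHOLE range `T(H(Y))` (the adjoint class is in `S(Y)` and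
  orthogonal to `S(Y)`, hence `0` by non-degeneracy ON `Y`).
* §2 **`exists_mem_span_absoluteHodge_map_eq_of_isAlgebraicCorrespondence` — THE LIFT: a class of `S(V)` in the range
  of an algebraic correspondence `T : H^{2p'}(Y) → H^{2p}(V)` is `T` of a class of `S(Y)`** (`W^⊥⊥ = W` inside the
  non-degenerately paired `S^p(V) × S^{m-p}(V)`, ring2-b05 gen 36's `mem_of_forall_orthogonal`); submodule form
  `S^p(V) ∩ T(H(Y)) = T(S^{p'}(Y))`.
* §3 **`span_absoluteHodge_le_span_of_isDominatedByPowers` — under Arapura's domination `IsDominatedByPowers m V d X`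
  every class of `S(V)` is `Σ Tᵢ(yᵢ)` with `Tᵢ` algebraic correspondences from powers `X^{eᵢ}` and `yᵢ ∈ S(X^{eᵢ})`**
  (in print: `[V]` is a direct summand of `⊕ [X^{eᵢ}](jᵢ)` in the semisimple category of AH motives); hence
  **`absoluteHodge_algebraic_of_isDominatedByPowers` — ARAPURA'S LEMMA 4.2 FOR THE CLAUSE «absolute Hodge ⟹
  algebraic»: if it holds on every power of `X` (all codimensions) it holds on every `V` dominated by the powers of
  `X`**; positive-powers form (`X⁰ = Spec ℂ` carries only algebraic classes in the relevant degrees).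

WHY IT IS WORTH A LINE. Gen 75's census: «NOT obtained: the absolute-road curve-power form WITHOUT c1 (Serre's
surjection is not equidimensional; AH descent is equidimensional-only in the tree), an AH-version of Arapura 4.2
(semisimplicity of AH motives — not in the tree)». This file supplies exactly that AH-version, modulo facts already of
record; the companion reads row b06 through it (curve powers without Deligne's Main Theorem; arbitrary surjections).

HONEST COLUMN. Nothing is discharged; row b06 does not occur; the six facts are OF RECORD and occur only as displayed
hypotheses; no definition, no new named fact, no sorry. NOT obtained: the `ℚ`-structure statements (single absolute
Hodge classes instead of their `ℂ`-span — for a RATIONAL class the conclusions `∈ algebraicClasses` coincide), the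
second conjunct of Arapura's record (the powers `V^{k+1}` — needs external products of correspondences), weak motivation.

PRESEARCH: [corpus: `paper:arxiv-math_0501348` Arapura 2006 §1 Lemma 1.1, §4 Lemma 4.2 (clauses `D`, `B`, `HC`, `GHC`;
`AC` for weak motivation) — the clause «absolute Hodge ⟹ algebraic» is NOT among the printed ones]; [corpus: Deligne–Milne
1982 II Prop. 6.5; Charles–Schnell 2014 §11.2.5 (11.2.17–11.2.18, Voisin's reduction)]; corpus hybrid/vector + galaxy
all stars «absolute Hodge classes are algebraic|dominated by|motivated by»: no printed statement of §3 found —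
certification by assembly, no novelty in print claimed.

References (bib keys): DeligneMilne1982Tannakian (II Prop. 6.1, 6.5), Arapura2006 (§1 Lemma 1.1, §4 Lemma 4.2),
CharlesSchnell2014Notes (Prop. 11.2.8, §11.2.5 11.2.17–11.2.18), Andre1996Motifs (Thm. 0.4 p. 7, Prop. 3.3 pp. 21–22,
§5.1 p. 25), FultonYoungTableaux1997 (App. B §B.1 (5)–(6)), HatcherAT2002 (§3.2 Thm. 3.2, §3.3 Thm. 3.26),
VoisinHodgeII2003 (proof of Thm. 10.17 (10.7), Prop. 9.20–9.21).
-/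

noncomputable section

set_option linter.dupNamespace false

open CategoryTheory AlgebraicGeometry MonoidalCategory CartesianMonoidalCategory
open Literature.AlgebraicTopology.SingularHomology Literature.Geometry.Kaehler
open Literature.AlgebraicGeometry Literature.AlgebraicGeometry.Motives
open Literature.AlgebraicGeometry.HodgeTheory
open Summit.HodgeConjecture.HodgeConjecture.Theorems

namespace Summit.HodgeConjecture.HodgeConjecture.Ring2.Hypotheses

variable {m n : ℕ} {V Y : SchemeOver ℂ}

/-! ## §1 Orthogonality propagates from `T(S(Y))` to the whole range `T(H(Y))` -/

/-- **If `b ∈ S^r(V)` (`p + r = m`) is cup-orthogonal to `T(S^{p'}(Y))` for an algebraic correspondence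
`T : H^{2p'}(Y(ℂ)) → H^{2p}(V(ℂ))`, then `T(y₀) ∪ b = 0` for EVERY `y₀ ∈ H^{2p'}(Y(ℂ); ℂ)`**, mod the six facts. With
`T = γ_*`: the adjoint class `s = snd_*(γ ∪ fst^* b)` lies in `S^{n-p'}(Y)` (`gysinMap_snd_cupProduct_map_fst_mem_span_absoluteHodge`)
and `⟨s ∪ y, [Y]⟩ = ⟨T y ∪ b, [V]⟩ = 0` for all `y ∈ S(Y)`, hence `s = 0` by the non-degeneracy of the cup pairing on
`S(Y)` (Deligne–Milne II 6.5, `nondegenerate_span_absoluteHodge`), hence `⟨T y₀ ∪ b, [V]_ν⟩ = ⟨s ∪ y₀, [Y]⟩ = 0`.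
Verbatim ring2-b05 gen 40's `cupProduct_corrClassAction_eq_zero_of_forall_motivated` with `A_mot ↦ S`.
[cite: DeligneMilne1982Tannakian, II Prop. 6.5] [cite: FultonYoungTableaux1997, Appendix B §B.1 (5)–(6)] -/
theorem cupProduct_corrClassAction_eq_zero_of_forall_absoluteHodge (hN : chartConjugation_canonical)
    (hex : ∀ ⦃n : ℕ⦄ ⦃X : SchemeOver ℂ⦄, IsSmoothProjective n X →
      ∀ (σ : ℂ ≃+* ℂ) (p : ℕ) (c : complexBetti X (2 * p)), ∃ s, IsConjugateClass σ X (2 * p) c s)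
    (hZ : deligne1982_cycleClass_absoluteHodge) (hL : deligne1982_lefschetz_absoluteHodge_iff)
    (hcup : deligne1982_cupProduct_absoluteHodge) (hgys : deligne1982_gysinFst_absoluteHodge)
    (hV : IsSmoothProjective m V) (hY : IsSmoothProjective n Y) {p p' r : ℕ} (hpr : p + r = m)
    {T : complexBetti Y (2 * p') →ₗ[ℂ] complexBetti V (2 * p)} (hT : IsAlgebraicCorrespondence m n V Y T)
    {b : complexBetti V (2 * r)} (hb : b ∈ Submodule.span ℂ {c : complexBetti V (2 * r) | IsAbsoluteHodgeClass m V r c})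
    (horth : ∀ y ∈ Submodule.span ℂ {c : complexBetti Y (2 * p') | IsAbsoluteHodgeClass n Y p' c},
      cupProduct (show 2 * p + 2 * r = 2 * m by omega) (T y) b = 0)
    (y₀ : complexBetti Y (2 * p')) : cupProduct (show 2 * p + 2 * r = 2 * m by omega) (T y₀) b = 0 := by
  classical
  -- no classes of degree `2p' > 2n`
  by_cases hp'n : n < p'
  · haveI := subsingleton_complexBetti hY (show 2 * n < 2 * p' by omega)
    rw [Subsingleton.elim y₀ 0, map_zero, map_zero, LinearMap.zero_apply]
  obtain ⟨p'', hp''⟩ : ∃ p'', p' + p'' = n := ⟨n - p', by omega⟩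
  obtain ⟨μ, ν, -, hν, e, q, hab, hq, γ, hγ, rfl⟩ := hT
  obtain rfl : q = 2 * r := by omega
  -- degrees of the adjoint class
  have h₁ : 2 * e + 2 * r = 2 * (p'' + m) := by omega
  have H₁ : 2 * (p'' + m) + 2 * p' = 2 * (m + n) := by omega
  have H₂ : 2 * p'' + 2 * p' = 2 * n := by omega
  -- the adjoint class is in `S(Y)` …
  have hs := gysinMap_snd_cupProduct_map_fst_mem_span_absoluteHodge hN hex hZ hcup hgys hV hY μ h₁ H₁ H₂ hγ hb
  -- … and cup-orthogonal to `S^{p'}(Y)`, hence zero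
  have hs0 : gysinMap μ (complexOrientationFamily hY) (AlgPoints.mapContinuous (L := ℂ) (snd V Y)) H₁ H₂
      (cupProduct h₁ γ (complexBetti.map (fst V Y) (2 * r) b)) = 0 := by
    refine (nondegenerate_span_absoluteHodge hZ hL hcup hY (show p'' + p' = n by omega)).1 _ hs fun y hy ↦ ?_
    refine cupProduct_eq_zero_of_cupPairing_eq_zero complexOrientationFamily hY _ ?_
    rw [← cupPairing_corrClassAction_eq_cupPairing_gysinMap_snd hY μ ν hν hab hq h₁ H₁ H₂ γ y b,
      cupPairing_apply, horth y hy, map_zero, LinearMap.zero_apply]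
  -- conclude for an arbitrary `y₀`
  refine eq_zero_of_kroneckerPairing_eq_zero_of_orientation hV ν ?_
  rw [← cupPairing_apply, cupPairing_corrClassAction_eq_cupPairing_gysinMap_snd hY μ ν hν hab hq h₁ H₁ H₂ γ y₀ b,
    hs0, map_zero, LinearMap.zero_apply]

/-! ## §2 The lift: a class of `S(V)` in the range of an algebraic correspondence has a preimage in `S(Y)` -/

/-- **DELIGNE–MILNE'S SEMISIMPLICITY LIFT ALONG AN ALGEBRAIC CORRESPONDENCE, on the real carriers** (mod the six
facts). For `V`, `Y` smooth projective complex varieties of dimensions `m`, `n`, `T : H^{2p'}(Y(ℂ); ℂ) → H^{2p}(V(ℂ); ℂ)`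
induced by an algebraic correspondence and a class `c ∈ S^p(V)` in the range of `T`: there is `y ∈ S^{p'}(Y)` with
`T y = c`. In print: the image of the morphism `T` of motives for absolute Hodge cycles is a direct summand (II Prop.
6.5) and an absolute Hodge class in its realisation lifts. Here: `W := T(S^{p'}(Y)) ≤ S^p(V)` (CS 11.2.8,
`map_mem_span_absoluteHodge_of_isAlgebraicCorrespondence`); a class of `S(V)` of complementary codimension orthogonal to
`W` is orthogonal to the whole range of `T` (§1), in particular to `c`; so `c ∈ W^⊥⊥ = W` (non-degeneracy on `V`,
ring2-b05 gen 36's `mem_of_forall_orthogonal`). [cite: DeligneMilne1982Tannakian, II Prop. 6.5]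
[cite: Arapura2006, §4 proof of Lemma 4.2] [cite: Andre1996Motifs, Thm. 0.4 (p. 7) and §5.1 (p. 25)] -/
theorem exists_mem_span_absoluteHodge_map_eq_of_isAlgebraicCorrespondence (hN : chartConjugation_canonical)
    (hex : ∀ ⦃n : ℕ⦄ ⦃X : SchemeOver ℂ⦄, IsSmoothProjective n X →
      ∀ (σ : ℂ ≃+* ℂ) (p : ℕ) (c : complexBetti X (2 * p)), ∃ s, IsConjugateClass σ X (2 * p) c s)
    (hZ : deligne1982_cycleClass_absoluteHodge) (hL : deligne1982_lefschetz_absoluteHodge_iff)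
    (hcup : deligne1982_cupProduct_absoluteHodge) (hgys : deligne1982_gysinFst_absoluteHodge)
    (hV : IsSmoothProjective m V) (hY : IsSmoothProjective n Y) {p p' : ℕ}
    {T : complexBetti Y (2 * p') →ₗ[ℂ] complexBetti V (2 * p)} (hT : IsAlgebraicCorrespondence m n V Y T)
    {c : complexBetti V (2 * p)} (hc : c ∈ Submodule.span ℂ {c : complexBetti V (2 * p) | IsAbsoluteHodgeClass m V p c})
    (hcT : c ∈ LinearMap.range T) :
    ∃ y ∈ Submodule.span ℂ {c : complexBetti Y (2 * p') | IsAbsoluteHodgeClass n Y p' c}, T y = c := by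
  classical
  by_cases hpm : m < p
  · haveI := subsingleton_complexBetti hV (show 2 * m < 2 * p by omega)
    exact ⟨0, Submodule.zero_mem _, Subsingleton.elim _ _⟩
  obtain ⟨r, hpr⟩ : ∃ r, p + r = m := ⟨m - p, by omega⟩
  obtain ⟨y₀, rfl⟩ := hcT
  set W : Submodule ℂ (complexBetti V (2 * p)) :=
    (Submodule.span ℂ {c : complexBetti Y (2 * p') | IsAbsoluteHodgeClass n Y p' c}).map T with hWdef
  have hWle : W ≤ Submodule.span ℂ {c : complexBetti V (2 * p) | IsAbsoluteHodgeClass m V p c} := by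
    rintro _ ⟨y, hy, rfl⟩
    exact map_mem_span_absoluteHodge_of_isAlgebraicCorrespondence hN hex hZ hcup hgys hV hY hT hy
  haveI := finite_complexBetti hV (2 * p)
  haveI := finite_complexBetti hV (2 * r)
  haveI := finite_complexBetti hV (2 * m)
  obtain ⟨hD₁, hD₂⟩ := nondegenerate_span_absoluteHodge hZ hL hcup hV hpr
  have hmem : T y₀ ∈ W :=
    mem_of_forall_orthogonal (finrank_complexBetti_top hV)
      (cupProduct (show 2 * p + 2 * r = 2 * m by omega))
      (Submodule.span ℂ {c : complexBetti V (2 * p) | IsAbsoluteHodgeClass m V p c})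
      (Submodule.span ℂ {c : complexBetti V (2 * r) | IsAbsoluteHodgeClass m V r c}) hD₁ hD₂
      hWle hc fun b hb hbW ↦
        cupProduct_corrClassAction_eq_zero_of_forall_absoluteHodge hN hex hZ hL hcup hgys hV hY hpr hT hb
          (fun y hy ↦ hbW _ ⟨y, hy, rfl⟩) y₀
  obtain ⟨y, hy, hyc⟩ := hmem
  exact ⟨y, hy, hyc⟩

/-- **Submodule form**: `S^p(V) ∩ T(H^{2p'}(Y)) = T(S^{p'}(Y))` for an algebraic correspondence `T` (`≥` is CS 11.2.8),
mod the six facts. [cite: DeligneMilne1982Tannakian, II Prop. 6.5] [cite: CharlesSchnell2014Notes, Prop. 11.2.8 (1)–(2)] -/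
theorem span_absoluteHodge_inf_range_eq_map_of_isAlgebraicCorrespondence (hN : chartConjugation_canonical)
    (hex : ∀ ⦃n : ℕ⦄ ⦃X : SchemeOver ℂ⦄, IsSmoothProjective n X →
      ∀ (σ : ℂ ≃+* ℂ) (p : ℕ) (c : complexBetti X (2 * p)), ∃ s, IsConjugateClass σ X (2 * p) c s)
    (hZ : deligne1982_cycleClass_absoluteHodge) (hL : deligne1982_lefschetz_absoluteHodge_iff)
    (hcup : deligne1982_cupProduct_absoluteHodge) (hgys : deligne1982_gysinFst_absoluteHodge)
    (hV : IsSmoothProjective m V) (hY : IsSmoothProjective n Y) {p p' : ℕ}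
    {T : complexBetti Y (2 * p') →ₗ[ℂ] complexBetti V (2 * p)} (hT : IsAlgebraicCorrespondence m n V Y T) :
    Submodule.span ℂ {c : complexBetti V (2 * p) | IsAbsoluteHodgeClass m V p c} ⊓ LinearMap.range T =
      (Submodule.span ℂ {c : complexBetti Y (2 * p') | IsAbsoluteHodgeClass n Y p' c}).map T := by
  refine le_antisymm (fun c hc ↦ ?_) ?_
  · obtain ⟨y, hy, hyc⟩ := exists_mem_span_absoluteHodge_map_eq_of_isAlgebraicCorrespondence hN hex hZ hL hcup hgys
      hV hY hT hc.1 hc.2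
    exact ⟨y, hy, hyc⟩
  · rintro _ ⟨y, hy, rfl⟩
    exact ⟨map_mem_span_absoluteHodge_of_isAlgebraicCorrespondence hN hex hZ hcup hgys hV hY hT hy,
      LinearMap.mem_range_self T y⟩

/-! ## §3 Domination by powers: Arapura's Lemma 4.2 for the clause «absolute Hodge ⟹ algebraic» -/

section Dominated

variable {d : ℕ} {X : SchemeOver ℂ}

/-- **THE SPAN LIFT UNDER DOMINATION** (mod the six facts). If `V` (smooth projective, dimension `m`) is dominated by the
powers of `X` (dimension `d`) through algebraic correspondences (`HodgeTheory.IsDominatedByPowers m V d X`, Arapura's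
Lemma 1.1 in algebraic form), then every class of `S^p(V)` is a finite sum `Σ Tᵢ(yᵢ)` with
`Tᵢ : H^{2pᵢ'}(X^{eᵢ}(ℂ)) → H^{2p}(V(ℂ))` algebraic correspondences and `yᵢ ∈ S^{pᵢ'}(X^{eᵢ})`. (In print: `[V]` is a direct
summand of `⊕[X^{eᵢ}](jᵢ)` in the SEMISIMPLE category of motives for absolute Hodge cycles, Deligne–Milne II 6.5.) Proof
as ring2-b05 gen 40's `motivatedClasses_le_span_of_isDominatedByPowers` with `A_mot ↦ S`: `W :=` the span of such
`Tᵢ(yᵢ)` is `≤ S^p(V)`; a class of `S(V)` of complementary codimension orthogonal to `W` is orthogonal to every range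
`T(H(X^e))` (§1), i.e. to all of `H^{2p}(V(ℂ))` by domination, so `S^p(V) ≤ W^⊥⊥ = W`.
[cite: Arapura2006, §1 Lemma 1.1 and §4 proof of Lemma 4.2] [cite: DeligneMilne1982Tannakian, II Prop. 6.5] -/
theorem span_absoluteHodge_le_span_of_isDominatedByPowers (hN : chartConjugation_canonical)
    (hex : ∀ ⦃n : ℕ⦄ ⦃X : SchemeOver ℂ⦄, IsSmoothProjective n X →
      ∀ (σ : ℂ ≃+* ℂ) (p : ℕ) (c : complexBetti X (2 * p)), ∃ s, IsConjugateClass σ X (2 * p) c s)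
    (hZ : deligne1982_cycleClass_absoluteHodge) (hL : deligne1982_lefschetz_absoluteHodge_iff)
    (hcup : deligne1982_cupProduct_absoluteHodge) (hgys : deligne1982_gysinFst_absoluteHodge)
    (hV : IsSmoothProjective m V) (hX : IsSmoothProjective d X) (hdom : IsDominatedByPowers m V d X) (p : ℕ) :
    Submodule.span ℂ {c : complexBetti V (2 * p) | IsAbsoluteHodgeClass m V p c} ≤
      Submodule.span ℂ
        {c : complexBetti V (2 * p) |
          ∃ (e p' : ℕ) (T : complexBetti (X.pow e) (2 * p') →ₗ[ℂ] complexBetti V (2 * p))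
            (y : complexBetti (X.pow e) (2 * p')),
            IsAlgebraicCorrespondence m (e * d) V (X.pow e) T ∧
              y ∈ Submodule.span ℂ {c : complexBetti (X.pow e) (2 * p') | IsAbsoluteHodgeClass (e * d) (X.pow e) p' c} ∧
                c = T y} := by
  classical
  intro c hc
  by_cases hpm : m < p
  · haveI := subsingleton_complexBetti hV (show 2 * m < 2 * p by omega)
    rw [Subsingleton.elim c 0]
    exact Submodule.zero_mem _
  obtain ⟨r, hpr⟩ : ∃ r, p + r = m := ⟨m - p, by omega⟩
  set W := Submodule.span ℂ
        {c : complexBetti V (2 * p) |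
          ∃ (e p' : ℕ) (T : complexBetti (X.pow e) (2 * p') →ₗ[ℂ] complexBetti V (2 * p))
            (y : complexBetti (X.pow e) (2 * p')),
            IsAlgebraicCorrespondence m (e * d) V (X.pow e) T ∧
              y ∈ Submodule.span ℂ {c : complexBetti (X.pow e) (2 * p') | IsAbsoluteHodgeClass (e * d) (X.pow e) p' c} ∧
                c = T y} with hWdef
  have hWle : W ≤ Submodule.span ℂ {c : complexBetti V (2 * p) | IsAbsoluteHodgeClass m V p c} := by
    refine Submodule.span_le.2 ?_
    rintro _ ⟨e, p', T, y, hT, hy, rfl⟩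
    exact map_mem_span_absoluteHodge_of_isAlgebraicCorrespondence hN hex hZ hcup hgys hV (hX.pow e) hT hy
  haveI := finite_complexBetti hV (2 * p)
  haveI := finite_complexBetti hV (2 * r)
  haveI := finite_complexBetti hV (2 * m)
  obtain ⟨hD₁, hD₂⟩ := nondegenerate_span_absoluteHodge hZ hL hcup hV hpr
  refine mem_of_forall_orthogonal (finrank_complexBetti_top hV)
    (cupProduct (show 2 * p + 2 * r = 2 * m by omega))
    (Submodule.span ℂ {c : complexBetti V (2 * p) | IsAbsoluteHodgeClass m V p c})
    (Submodule.span ℂ {c : complexBetti V (2 * r) | IsAbsoluteHodgeClass m V r c}) hD₁ hD₂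
    hWle hc fun b hb hbW ↦ ?_
  -- `b` is orthogonal to every range of an algebraic correspondence from a power of `X`, i.e. to `H^{2p}(V(ℂ))`
  have hc' : c ∈ Submodule.span ℂ
      {c : complexBetti V (2 * p) |
        ∃ (e a : ℕ) (T : complexBetti (X.pow e) a →ₗ[ℂ] complexBetti V (2 * p)),
          IsAlgebraicCorrespondence m (e * d) V (X.pow e) T ∧ c ∈ LinearMap.range T} := by
    rw [hdom (2 * p)]
    exact Submodule.mem_top
  have hker : c ∈ LinearMap.ker ((cupProduct (show 2 * p + 2 * r = 2 * m by omega)).flip b) := by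
    refine (Submodule.span_le.2 ?_) hc'
    rintro c' ⟨e, a, T, hT, ⟨y₀, rfl⟩⟩
    -- the source degree is even
    have hpar : ∃ p', a = 2 * p' := by
      obtain ⟨-, -, -, -, e', -, hab', -⟩ := hT
      exact ⟨a / 2, by omega⟩
    obtain ⟨p', rfl⟩ := hpar
    rw [SetLike.mem_coe, LinearMap.mem_ker, LinearMap.flip_apply]
    exact cupProduct_corrClassAction_eq_zero_of_forall_absoluteHodge hN hex hZ hL hcup hgys hV (hX.pow e) hpr hT hb
      (fun y hy ↦ hbW _ (Submodule.subset_span ⟨e, p', T, y, hT, hy, rfl⟩)) y₀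
  rwa [LinearMap.mem_ker, LinearMap.flip_apply] at hker

/-- **ARAPURA'S LEMMA 4.2 FOR THE CLAUSE «ABSOLUTE HODGE ⟹ ALGEBRAIC» (real carriers, kernel theorem modulo the six
facts of record).** If `V` is dominated by the powers of `X` and on every cartesian power `X^e` (dimension `e·d`) every
absolute Hodge class is algebraic (all codimensions), then every absolute Hodge class of `V` is algebraic: by the span
lift it is `Σ Tᵢ(yᵢ)` with `yᵢ ∈ S(X^{eᵢ}) ⊆ N(X^{eᵢ})`, and algebraic correspondences preserve algebraic classes
(Voisin II Prop. 9.21 with (10.7), the tree's fact-free `AbelianAll.map_mem_algebraicClasses_of_isAlgebraicCorrespondence`).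
The hypothesis on the powers is NOT asserted. [cite: Arapura2006, §4 Lemma 4.2 and §1 Lemma 1.1]
[cite: DeligneMilne1982Tannakian, II Prop. 6.5] [cite: VoisinHodgeII2003, §9.2.4 Prop. 9.20–9.21 and (10.7)] -/
theorem absoluteHodge_algebraic_of_isDominatedByPowers (hN : chartConjugation_canonical)
    (hex : ∀ ⦃n : ℕ⦄ ⦃X : SchemeOver ℂ⦄, IsSmoothProjective n X →
      ∀ (σ : ℂ ≃+* ℂ) (p : ℕ) (c : complexBetti X (2 * p)), ∃ s, IsConjugateClass σ X (2 * p) c s)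
    (hZ : deligne1982_cycleClass_absoluteHodge) (hL : deligne1982_lefschetz_absoluteHodge_iff)
    (hcup : deligne1982_cupProduct_absoluteHodge) (hgys : deligne1982_gysinFst_absoluteHodge)
    (hV : IsSmoothProjective m V) (hX : IsSmoothProjective d X) (hdom : IsDominatedByPowers m V d X)
    (hpow : ∀ (e p' : ℕ) (y : complexBetti (X.pow e) (2 * p')),
      IsAbsoluteHodgeClass (e * d) (X.pow e) p' y → y ∈ algebraicClasses (X.pow e) p')
    (p : ℕ) (c : complexBetti V (2 * p)) (hc : IsAbsoluteHodgeClass m V p c) : c ∈ algebraicClasses V p := by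
  have hcS := span_absoluteHodge_le_span_of_isDominatedByPowers hN hex hZ hL hcup hgys hV hX hdom p
    (Submodule.subset_span hc)
  refine (Submodule.span_le.2 ?_) hcS
  rintro _ ⟨e, p', T, y, hT, hy, rfl⟩
  have hyalg : y ∈ algebraicClasses (X.pow e) p' :=
    (Submodule.span_le.2 fun y hy ↦ hpow e p' y hy) hy
  exact Ring2.AbelianAll.map_mem_algebraicClasses_of_isAlgebraicCorrespondence hV (hX.pow e) hT hyalg

/-- **On the power `X⁰ = Spec ℂ` every class of positive even degree vanishes and every class of degree `0` is
algebraic** — the zeroth power needs no hypothesis. [cite: Arapura2006, §1 Lemma 1.1] -/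
theorem algebraic_pow_zero (hX : IsSmoothProjective d X) (p' : ℕ) (y : complexBetti (X.pow 0) (2 * p')) :
    y ∈ algebraicClasses (X.pow 0) p' := by
  rcases Nat.eq_zero_or_pos p' with rfl | hp
  · rw [algebraicClasses_zero]
    exact Submodule.mem_top
  · haveI := subsingleton_complexBetti (hX.pow 0) (show 2 * (0 * d) < 2 * p' by omega)
    rw [Subsingleton.elim y 0]
    exact Submodule.zero_mem _

/-- **Positive-powers form** of `absoluteHodge_algebraic_of_isDominatedByPowers` (mod the six facts): it suffices that
«absolute Hodge ⟹ algebraic» hold on the POSITIVE powers `X^{k+1}` (`X⁰ = Spec ℂ` is covered by `algebraic_pow_zero`).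
[cite: Arapura2006, §4 Lemma 4.2 and §1 Lemma 1.1] [cite: DeligneMilne1982Tannakian, II Prop. 6.5] -/
theorem absoluteHodge_algebraic_of_isDominatedByPowers_succ (hN : chartConjugation_canonical)
    (hex : ∀ ⦃n : ℕ⦄ ⦃X : SchemeOver ℂ⦄, IsSmoothProjective n X →
      ∀ (σ : ℂ ≃+* ℂ) (p : ℕ) (c : complexBetti X (2 * p)), ∃ s, IsConjugateClass σ X (2 * p) c s)
    (hZ : deligne1982_cycleClass_absoluteHodge) (hL : deligne1982_lefschetz_absoluteHodge_iff)
    (hcup : deligne1982_cupProduct_absoluteHodge) (hgys : deligne1982_gysinFst_absoluteHodge)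
    (hV : IsSmoothProjective m V) (hX : IsSmoothProjective d X) (hdom : IsDominatedByPowers m V d X)
    (hpow : ∀ (k p' : ℕ) (y : complexBetti (X.pow (k + 1)) (2 * p')),
      IsAbsoluteHodgeClass ((k + 1) * d) (X.pow (k + 1)) p' y → y ∈ algebraicClasses (X.pow (k + 1)) p')
    (p : ℕ) (c : complexBetti V (2 * p)) (hc : IsAbsoluteHodgeClass m V p c) : c ∈ algebraicClasses V p := by
  refine absoluteHodge_algebraic_of_isDominatedByPowers hN hex hZ hL hcup hgys hV hX hdom (fun e p' y hy ↦ ?_) p c hc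
  cases e with
  | zero => exact algebraic_pow_zero hX p' y
  | succ k => exact hpow k p' y hy

end Dominated

end Summit.HodgeConjecture.HodgeConjecture.Ring2.Hypotheses

end
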